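import Mathlib
import HarnessLib
import Summits.Ventures.LatticeQCDFlow.Scoring.GaussianStudentLimit

/-!
# THE TWO-SAMPLE STUDENT-TYPE CALIBRATION TENDS TO THE NORMAL ONE AS THE NUMBER OF BATCHES GROWS:
# `lim_{a→∞} (N(0,1)^{⊗a})^{⊗2}{(g, h) | a·(ḡ − h̄)² ≤ z²·(s²(g) + s²(h))} = N(0,1)([−z, z])`

HONEST FRAMING: exact (Metropolis-corrected) sampling algorithms for lattice gauge theory;
figures of merit are autocorrelation/cost numbers at stated couplings and volumes; no
continuum-physics claim.

Venture `LatticeQCDFlow` (cell pub-lqcd), topic `Scoring`; FANOUT row 4 (`s0-u1-b`, GEN-32).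
NEW WORK of the cell (classical; not in Mathlib), no definition, nothing cited as a fact.

Companion of `Scoring/GaussianStudentLimit.lean` (one sample) for the A-vs-B comparisons at a
FIXED number `a` of batches per run / of replicas per arm: their coverage tends to the two-sample
Student-type Gaussian functional `(N(0,1)^{⊗a})^{⊗2}{(g, h) | a·(ḡ − h̄)² ≤ z²·(s²(g) + s²(h))}`,
and this file proves that this functional tends to `N(0,1)([−z, z])` as `a → ∞` (Student's
`t_{2a−2}` law tends to the standard normal one), again on the event itself, without densities.

Proof.  On `Ω = (ℕ → ℝ) × (ℕ → ℝ)` with `P ⊗ P`, `P = N(0,1)^{⊗ℕ}`, the pair of first-`a`-coordinate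
vectors has law `(N(0,1)^{⊗a})^{⊗2}` (independence of the two components of a product measure and
the one-sample law `GaussianStudentLimit.infinitePi_gaussian_hasLaw_truncate`); the statistic
`Nₐ = ((∑_{i<a} ω.1ᵢ)/√a − (∑_{i<a} ω.2ᵢ)/√a)/√2` has law EXACTLY `N(0,1)` for `a ≥ 1` (difference of
two independent standard normals, rescaled); `(s²ₐ(ω.1) + s²ₐ(ω.2))/2 → 1` almost surely (the
one-sample strong law on each component); Slutsky and the portmanteau theorem on `(−∞, 0]` finish
as in the one-sample file, the functional being `P ⊗ P (Nₐ² − z²·(s²ₐ(ω.1) + s²ₐ(ω.2))/2 ≤ 0)`.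

## Content

* `infinitePi_gaussian_prod_hasLaw_truncate` — the pair of truncations has law `(N(0,1)^{⊗a})^{⊗2}`.
* `infinitePi_gaussian_prod_hasLaw_scaledDiff` — `Nₐ` is EXACTLY `N(0,1)` (`1 ≤ a`).
* `infinitePi_gaussian_prod_pooledVariance_tendsto_ae` — `(s²ₐ(ω.1) + s²ₐ(ω.2))/2 → 1` a.s.
* **`pi_gaussianReal_twoSample_student_tendsto_gaussian`** — the headline limit; the event is
  VERBATIM the limit event of the cell's two-run fixed-batch-count and two-arm fixed-replica-count
  coverage theorems.

Depends on: `Scoring/GaussianStudentLimit` (one-sample pieces), `Scoring/AsymptoticCoverage`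
(portmanteau on a continuity set), Mathlib (`indepFun_prod`, `gaussianReal_add_gaussianReal_of_indepFun`,
Slutsky).  [ours] throughout.
-/

open MeasureTheory ProbabilityTheory Filter Topology

namespace Summit.Ventures.LatticeQCDFlow.Scoring

section TwoSample

/-- **The pair of first-`a`-coordinate vectors of `N(0,1)^{⊗ℕ} ⊗ N(0,1)^{⊗ℕ}` has law
`N(0,1)^{⊗a} ⊗ N(0,1)^{⊗a}`.** [ours] -/
theorem infinitePi_gaussian_prod_hasLaw_truncate (a : ℕ) :
    HasLaw (fun ω : (ℕ → ℝ) × (ℕ → ℝ) =>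
        ((fun j : Fin a => ω.1 (j : ℕ)), (fun j : Fin a => ω.2 (j : ℕ))))
      ((Measure.pi fun _ : Fin a => gaussianReal 0 1).prod (Measure.pi fun _ : Fin a => gaussianReal 0 1))
      ((Measure.infinitePi fun _ : ℕ => gaussianReal 0 1).prod
        (Measure.infinitePi fun _ : ℕ => gaussianReal 0 1)) := by
  set P := Measure.infinitePi fun _ : ℕ => gaussianReal 0 1 with hP
  have hm : Measurable (fun (η : ℕ → ℝ) (j : Fin a) => η (j : ℕ)) :=
    measurable_pi_lambda _ fun j => measurable_pi_apply _
  have h1 : HasLaw ((fun (η : ℕ → ℝ) (j : Fin a) => η (j : ℕ)) ∘ Prod.fst)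
      (Measure.pi fun _ : Fin a => gaussianReal 0 1) (P.prod P) :=
    (infinitePi_gaussian_hasLaw_truncate a).comp (measurePreserving_fst (μ := P) (ν := P)).hasLaw
  have h2 : HasLaw ((fun (η : ℕ → ℝ) (j : Fin a) => η (j : ℕ)) ∘ Prod.snd)
      (Measure.pi fun _ : Fin a => gaussianReal 0 1) (P.prod P) :=
    (infinitePi_gaussian_hasLaw_truncate a).comp (measurePreserving_snd (μ := P) (ν := P)).hasLaw
  have hind : IndepFun ((fun (η : ℕ → ℝ) (j : Fin a) => η (j : ℕ)) ∘ Prod.fst)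
      ((fun (η : ℕ → ℝ) (j : Fin a) => η (j : ℕ)) ∘ Prod.snd) (P.prod P) :=
    indepFun_prod hm hm
  refine ⟨(h1.aemeasurable.prodMk h2.aemeasurable), ?_⟩
  show (P.prod P).map (fun ω => (((fun (η : ℕ → ℝ) (j : Fin a) => η (j : ℕ)) ∘ Prod.fst) ω,
      ((fun (η : ℕ → ℝ) (j : Fin a) => η (j : ℕ)) ∘ Prod.snd) ω)) = _
  rw [(indepFun_iff_map_prod_eq_prod_map_map h1.aemeasurable h2.aemeasurable).1 hind, h1.map_eq,
    h2.map_eq]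

/-- **`((∑_{i<a} ω.1ᵢ)/√a − (∑_{i<a} ω.2ᵢ)/√a)/√2` is EXACTLY `N(0,1)` under `P ⊗ P`, `a ≥ 1`.** [ours] -/
theorem infinitePi_gaussian_prod_hasLaw_scaledDiff {a : ℕ} (ha : 1 ≤ a) :
    HasLaw (fun ω : (ℕ → ℝ) × (ℕ → ℝ) =>
        ((∑ i ∈ Finset.range a, ω.1 i) / Real.sqrt a - (∑ i ∈ Finset.range a, ω.2 i) / Real.sqrt a)
          / Real.sqrt 2)
      (gaussianReal 0 1)
      ((Measure.infinitePi fun _ : ℕ => gaussianReal 0 1).prod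
        (Measure.infinitePi fun _ : ℕ => gaussianReal 0 1)) := by
  set P := Measure.infinitePi fun _ : ℕ => gaussianReal 0 1 with hP
  have hSm : Measurable (fun η : ℕ → ℝ => (∑ i ∈ Finset.range a, η i) / Real.sqrt a) :=
    (Finset.measurable_sum _ fun i _ => measurable_pi_apply i).div_const _
  have hU : HasLaw ((fun η : ℕ → ℝ => (∑ i ∈ Finset.range a, η i) / Real.sqrt a) ∘ Prod.fst)
      (gaussianReal 0 1) (P.prod P) :=
    (infinitePi_gaussian_hasLaw_scaledSum ha).comp (measurePreserving_fst (μ := P) (ν := P)).hasLaw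
  have hW : HasLaw ((fun η : ℕ → ℝ => (∑ i ∈ Finset.range a, η i) / Real.sqrt a) ∘ Prod.snd)
      (gaussianReal 0 1) (P.prod P) :=
    (infinitePi_gaussian_hasLaw_scaledSum ha).comp (measurePreserving_snd (μ := P) (ν := P)).hasLaw
  have hind : IndepFun ((fun η : ℕ → ℝ => (∑ i ∈ Finset.range a, η i) / Real.sqrt a) ∘ Prod.fst)
      ((fun η : ℕ → ℝ => (∑ i ∈ Finset.range a, η i) / Real.sqrt a) ∘ Prod.snd) (P.prod P) :=
    indepFun_prod hSm hSm
  have hnegW := gaussianReal_neg hW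
  have hind' : IndepFun ((fun η : ℕ → ℝ => (∑ i ∈ Finset.range a, η i) / Real.sqrt a) ∘ Prod.fst)
      (-((fun η : ℕ → ℝ => (∑ i ∈ Finset.range a, η i) / Real.sqrt a) ∘ Prod.snd)) (P.prod P) :=
    hind.comp measurable_id measurable_neg
  have hsum := gaussianReal_add_gaussianReal_of_indepFun hind' hU.map_eq hnegW.map_eq
  rw [neg_zero, add_zero] at hsum
  have hD : HasLaw (fun ω : (ℕ → ℝ) × (ℕ → ℝ) =>
      (∑ i ∈ Finset.range a, ω.1 i) / Real.sqrt a - (∑ i ∈ Finset.range a, ω.2 i) / Real.sqrt a)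
      (gaussianReal 0 (1 + 1)) (P.prod P) := by
    refine ⟨((hSm.comp measurable_fst).sub (hSm.comp measurable_snd)).aemeasurable, ?_⟩
    rw [← hsum]
    congr 1
  have h := gaussianReal_div_const hD (Real.sqrt 2)
  rw [zero_div] at h
  convert h using 2
  apply NNReal.eq
  rw [NNReal.coe_div, NNReal.coe_add, NNReal.coe_mk, Real.sq_sqrt (by norm_num : (0 : ℝ) ≤ 2),
    NNReal.coe_one]
  norm_num

/-- **The pooled sample variance `(s²ₐ(ω.1) + s²ₐ(ω.2))/2 → 1` almost surely under `P ⊗ P`.** [ours] -/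
theorem infinitePi_gaussian_prod_pooledVariance_tendsto_ae :
    ∀ᵐ ω ∂((Measure.infinitePi fun _ : ℕ => gaussianReal 0 1).prod
        (Measure.infinitePi fun _ : ℕ => gaussianReal 0 1)),
      Tendsto (fun n : ℕ =>
        ((∑ j ∈ Finset.range n, (ω.1 j - (∑ i ∈ Finset.range n, ω.1 i) / (n : ℝ)) ^ 2) / ((n : ℝ) - 1)
          + (∑ j ∈ Finset.range n, (ω.2 j - (∑ i ∈ Finset.range n, ω.2 i) / (n : ℝ)) ^ 2) / ((n : ℝ) - 1))
          / 2)
        atTop (𝓝 (1 : ℝ)) := by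
  set P := Measure.infinitePi fun _ : ℕ => gaussianReal 0 1 with hP
  have h1 := (Measure.quasiMeasurePreserving_fst (μ := P) (ν := P)).ae infinitePi_gaussian_sampleVariance_tendsto_ae
  have h2 := (Measure.quasiMeasurePreserving_snd (μ := P) (ν := P)).ae infinitePi_gaussian_sampleVariance_tendsto_ae
  filter_upwards [h1, h2] with ω hA hB
  have h := (hA.add hB).div_const 2
  rw [show ((1 : ℝ) + 1) / 2 = 1 by norm_num] at h
  exact h

/-- **THE TWO-SAMPLE STUDENT-TYPE CALIBRATION TENDS TO THE NORMAL ONE.**  For `0 ≤ z`,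
`(N(0,1)^{⊗a} ⊗ N(0,1)^{⊗a}){(g, h) | a·(ḡ − h̄)² ≤ z²·(s²(g) + s²(h))} → N(0,1)([−z, z])` as `a → ∞`;
the event is VERBATIM the limit event of the cell's two-run fixed-batch-count and two-arm
fixed-replica-count coverage theorems (equal batch / replica counts), so their iterated limit
(`n → ∞`, then `a → ∞`) is the nominal `N(0,1)([−z, z])`. [ours] -/
theorem pi_gaussianReal_twoSample_student_tendsto_gaussian {z : ℝ} (hz : 0 ≤ z) :
    Tendsto (fun a : ℕ => ((Measure.pi fun _ : Fin a => gaussianReal 0 1).prod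
          (Measure.pi fun _ : Fin a => gaussianReal 0 1)).real
        {p : (Fin a → ℝ) × (Fin a → ℝ) | (a : ℝ) * ((∑ i, p.1 i) / (a : ℝ) - (∑ i, p.2 i) / (a : ℝ)) ^ 2
            ≤ z ^ 2 * (((∑ j, (p.1 j - (∑ i, p.1 i) / (a : ℝ)) ^ 2) / ((a : ℝ) - 1))
              + ((∑ j, (p.2 j - (∑ i, p.2 i) / (a : ℝ)) ^ 2) / ((a : ℝ) - 1)))})
      atTop (𝓝 ((gaussianReal 0 1).real (Set.Icc (-z) z))) := by
  set P := Measure.infinitePi fun _ : ℕ => gaussianReal 0 1 with hP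
  -- the two statistics on the one space `((ℕ → ℝ) × (ℕ → ℝ), P ⊗ P)`
  set N : ℕ → (ℕ → ℝ) × (ℕ → ℝ) → ℝ := fun a ω =>
    ((∑ i ∈ Finset.range a, ω.1 i) / Real.sqrt a - (∑ i ∈ Finset.range a, ω.2 i) / Real.sqrt a)
      / Real.sqrt 2 with hN
  set Y : ℕ → (ℕ → ℝ) × (ℕ → ℝ) → ℝ := fun a ω =>
    ((∑ j ∈ Finset.range a, (ω.1 j - (∑ i ∈ Finset.range a, ω.1 i) / (a : ℝ)) ^ 2) / ((a : ℝ) - 1)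
      + (∑ j ∈ Finset.range a, (ω.2 j - (∑ i ∈ Finset.range a, ω.2 i) / (a : ℝ)) ^ 2) / ((a : ℝ) - 1))
      / 2 with hY
  have hSm : ∀ a, Measurable (fun η : ℕ → ℝ => (∑ i ∈ Finset.range a, η i) / Real.sqrt a) := fun a =>
    (Finset.measurable_sum _ fun i _ => measurable_pi_apply i).div_const _
  have hVm : ∀ a, Measurable (fun η : ℕ → ℝ =>
      (∑ j ∈ Finset.range a, (η j - (∑ i ∈ Finset.range a, η i) / (a : ℝ)) ^ 2) / ((a : ℝ) - 1)) :=
    fun a => by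
    refine (Finset.measurable_sum _ fun j _ => ?_).div_const _
    exact ((measurable_pi_apply j).sub
      ((Finset.measurable_sum _ fun i _ => measurable_pi_apply i).div_const _)).pow_const 2
  have hNm : ∀ a, Measurable (N a) := fun a =>
    (((hSm a).comp measurable_fst).sub ((hSm a).comp measurable_snd)).div_const _
  have hYm : ∀ a, Measurable (Y a) := fun a =>
    (((hVm a).comp measurable_fst).add ((hVm a).comp measurable_snd)).div_const _
  -- (1) `N a ⇒ Z = id` on `(ℝ, N(0,1))`: eventually constant laws
  have hND : TendstoInDistribution N atTop (fun y : ℝ => y) (fun _ => P.prod P) (gaussianReal 0 1) := by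
    refine ⟨fun a => (hNm a).aemeasurable, aemeasurable_id, ?_⟩
    refine tendsto_const_nhds.congr' ?_
    filter_upwards [eventually_ge_atTop 1] with a ha
    apply Subtype.ext
    show (gaussianReal 0 1).map (fun y : ℝ => y) = (P.prod P).map (N a)
    exact Measure.map_id'.trans (infinitePi_gaussian_prod_hasLaw_scaledDiff ha).map_eq.symm
  -- (2) `Y a → 1` in probability
  have hYD : TendstoInMeasure (P.prod P) Y atTop (fun _ => (1 : ℝ)) :=
    tendstoInMeasure_of_tendsto_ae (fun a => (hYm a).aestronglyMeasurable)
      (by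
        filter_upwards [infinitePi_gaussian_prod_pooledVariance_tendsto_ae] with ω hω
        exact hω)
  -- (3) Slutsky
  have hφ := hND.continuous_comp_prodMk_of_tendstoInMeasure_const
    (g := fun p : ℝ × ℝ => p.1 ^ 2 - z ^ 2 * p.2) (by fun_prop) hYD (fun a => (hYm a).aemeasurable)
  -- (4) portmanteau on `(−∞, 0]`
  have hψm : Measurable fun y : ℝ => (fun p : ℝ × ℝ => p.1 ^ 2 - z ^ 2 * p.2) (y, 1) := by fun_prop
  haveI : NullSingletonClass (gaussianReal 0 1) := nullSingletonClass_gaussianReal one_ne_zero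
  have hfr : ((gaussianReal 0 1).map fun y : ℝ => (fun p : ℝ × ℝ => p.1 ^ 2 - z ^ 2 * p.2) (y, 1))
      (frontier (Set.Iic (0 : ℝ))) = 0 := by
    rw [frontier_Iic, Measure.map_apply hψm (measurableSet_singleton 0)]
    have hsub : (fun y : ℝ => (fun p : ℝ × ℝ => p.1 ^ 2 - z ^ 2 * p.2) (y, 1)) ⁻¹' {0} ⊆ {z, -z} := by
      intro y hy
      simp only [Set.mem_preimage, Set.mem_singleton_iff, mul_one] at hy
      have h2 : y ^ 2 = z ^ 2 := by linarith
      rcases sq_eq_sq_iff_eq_or_eq_neg.1 h2 with h | h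
      · simp [h]
      · simp [h]
    exact measure_mono_null hsub (Set.Countable.measure_zero (Set.toFinite _).countable _)
  have key := CardConsistency.tendsto_measureReal_preimage_of_tendstoInDistribution hφ
    measurableSet_Iic hfr
  have hlimset : (fun y : ℝ => (fun p : ℝ × ℝ => p.1 ^ 2 - z ^ 2 * p.2) (y, 1)) ⁻¹' Set.Iic 0
      = Set.Icc (-z) z := by
    ext y
    simp only [Set.mem_preimage, Set.mem_Iic, Set.mem_Icc, mul_one, sub_nonpos]
    rw [sq_le_sq, abs_of_nonneg hz, abs_le]
  rw [hlimset] at key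
  -- (5) for each `a ≥ 1` the functional is the probability of that event
  refine key.congr' ?_
  filter_upwards [eventually_ge_atTop 1] with a ha
  have haR : (0 : ℝ) < a := by exact_mod_cast ha
  have hp : MeasurableSet {p : (Fin a → ℝ) × (Fin a → ℝ) |
      (a : ℝ) * ((∑ i, p.1 i) / (a : ℝ) - (∑ i, p.2 i) / (a : ℝ)) ^ 2
        ≤ z ^ 2 * (((∑ j, (p.1 j - (∑ i, p.1 i) / (a : ℝ)) ^ 2) / ((a : ℝ) - 1))
          + ((∑ j, (p.2 j - (∑ i, p.2 i) / (a : ℝ)) ^ 2) / ((a : ℝ) - 1)))} :=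
    measurableSet_le (by fun_prop) (by fun_prop)
  rw [← (infinitePi_gaussian_prod_hasLaw_truncate a).measureReal_eq
    (p := fun p : (Fin a → ℝ) × (Fin a → ℝ) =>
      (a : ℝ) * ((∑ i, p.1 i) / (a : ℝ) - (∑ i, p.2 i) / (a : ℝ)) ^ 2
        ≤ z ^ 2 * (((∑ j, (p.1 j - (∑ i, p.1 i) / (a : ℝ)) ^ 2) / ((a : ℝ) - 1))
          + ((∑ j, (p.2 j - (∑ i, p.2 i) / (a : ℝ)) ^ 2) / ((a : ℝ) - 1)))) hp]
  congr 1
  ext ω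
  simp only [Set.mem_preimage, Set.mem_Iic, Set.mem_setOf_eq, sub_nonpos, hN, hY]
  rw [Fin.sum_univ_eq_sum_range (fun i => ω.1 i) a, Fin.sum_univ_eq_sum_range (fun i => ω.2 i) a,
    Fin.sum_univ_eq_sum_range (fun j => (ω.1 j - (∑ i ∈ Finset.range a, ω.1 i) / (a : ℝ)) ^ 2) a,
    Fin.sum_univ_eq_sum_range (fun j => (ω.2 j - (∑ i ∈ Finset.range a, ω.2 i) / (a : ℝ)) ^ 2) a]
  have hsa : Real.sqrt (a : ℝ) ≠ 0 := (Real.sqrt_pos.2 haR).ne'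
  have e : (((∑ i ∈ Finset.range a, ω.1 i) / Real.sqrt a - (∑ i ∈ Finset.range a, ω.2 i) / Real.sqrt a)
        / Real.sqrt 2) ^ 2
      = ((a : ℝ) * ((∑ i ∈ Finset.range a, ω.1 i) / (a : ℝ) - (∑ i ∈ Finset.range a, ω.2 i) / (a : ℝ)) ^ 2)
          / 2 := by
    rw [div_pow, Real.sq_sqrt (by norm_num : (0 : ℝ) ≤ 2), ← sub_div, div_pow, Real.sq_sqrt haR.le,
      ← sub_div, div_pow]
    field_simp
  rw [e]
  constructor
  · intro h
    linarith
  · intro h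
    linarith

end TwoSample

end Summit.Ventures.LatticeQCDFlow.Scoring
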